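import Summits.BirchSwinnertonDyer.BirchSwinnertonDyer.Theses.KolyvaginRoadThree
import Summits.BirchSwinnertonDyer.BirchSwinnertonDyer.Theorems.KolyvaginRoadThreeKernelHL
import Summits.BirchSwinnertonDyer.BirchSwinnertonDyer.Theorems.KolyvaginRoadThreePointCertificate
import Summits.BirchSwinnertonDyer.BirchSwinnertonDyer.Theorems.KolyvaginRoadThreeLevelData
import Summits.BirchSwinnertonDyer.Rank1Residual.X11b.BDPRouteRigidity
import Summits.BirchSwinnertonDyer.Rank1Residual.X11b.Three.KolyvaginLineCertificate
import Literature.NumberTheory.EllipticCurves.KolyvaginShaStructureDivisibility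
import Literature.NumberTheory.EllipticCurves.HeegnerPointsClassesProofs
import HarnessLib

/-!
# Route `KolyvaginRoadThree`, deciding crux `ZhangSharpFrameAtThreeHL` (item stmt-BirchSwinnertonDyer-19574): the HL
# crux is EQUIVALENT to the rung-K2@3 leaf on atom A1, modulo the published inputs
# (cell `bsd-stepL`, seat `bsd-stepL-zhang3-p1` g3; `--supports stmt-BirchSwinnertonDyer-19574`, helper)

THEOREMS ONLY (no definition, no named fact, no `sorry`); nothing about Kolyvagin's conjecture at `p = 3` and nothing
about `BSD(E,3)` is asserted; every published input is a named fact of the tree taken as a binder. PARTITION: O2@3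
(B10) × A1 (1 116 TRUE-OPEN classes; cw 248 943) — types-the-object-of; closes: none.

THE POINT. The HL kernel (`Koly.bsdp_three_onA1_of_kolyvaginFramesHL`, p424749) reads the deciding crux FORWARD:
Kolyvagin's conjecture mod 3 at every Hoffstein–Luo frame of an A1 curve ⟹ `BSDp W 3` on A1. This file proves the
CONVERSE from published inputs only, so that — modulo Gross–Zagier, Kolyvagin, Skinner 2016 Thm. C, GZK, modularity,
Shimura reciprocity at conductor 1, Gross 1991 §3 (CM rationality of `x_n`, `G_ℓ` cyclic) and BOTH halves of
McCallum 1991 Cor. 5.6 (the certificate half `McCallum1991_pow_dvd_card_sha_primary_of_certificate` used by the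
kernel, and the divisibility half `McCallum1991_padicValNat_card_sha_primary_add_le_of_globalDivisibility`, tam3-p1
p418283) — the deciding crux of the route is EXACTLY the leaf `X11b.MultiplicativeRankOneAtThree` restricted to its
atom A1 = (ram) ∧ `3 ∤ ∏c`, read through Kolyvagin classes:

  `ZhangSharpFrameAtThreeHL ⟺ ∀ W, ClassX11b W 3 → Ram W 3 → ¬ 3 ∣ ∏c_ℓ(W) → BSDp W 3`.

Consequences for the record: (i) the crux carries NO SURPLUS over the target on its atom (T1 strength); (ii) it cannot
be refuted without refuting the `3`-part of BSD at an A1 curve; (iii) the converse is available ONLY on the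
Hoffstein–Luo frame (`d_K` odd, `L(E^{d_K},1) ≠ 0`, where `r_an(E/K) = 1` and `y_K` is non-torsion) — the parent
frame 19153 quantifies also over fields with `r_an(E/K) ≥ 3`, where no such converse exists; this is the precise
sense in which the (B′)/D2 restatement is the right one.

MECHANISM of the converse at one HL frame `(K, Dt, β, ι)` of an A1 curve `W` (W. Zhang 2014 Remark 5 ∕ Thm. 10.2
read backwards; Jetchev 2008 §1 (1)): `BSDp W 3` gives STEP L at the Heegner point `P = y_K ∈ E(K)` of the frame
(`indexLowerBoundAt_of_bsdp_of_heegnerData_of_odd`: `2·ord₃[E(K):ℤP] ≤ ord₃ #Ш(E/K) + 2·ord₃ ∏c = ord₃ #Ш(E/K)`);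
if EVERY derived point `P(n)` on the frame (`n` a square-free product of Kolyvagin primes, `n = 1` allowed) were
divisible by `3` in `E(K[n])`, McCallum's Cor. 5.6 read with `M_∞ ≥ 1` would give `ord₃ #Ш(E/K)[3^∞] + 2 ≤ 2M₀`
with `3^{M₀} ∥ y_K`, and `M₀ = ord₃[E(K):ℤP]` (McCallum Lemma 5.1, tree bridge
`Koly.padicValNat_index_zmultiples_eq_of_divisibility`) — a contradiction. Hence some tower point `P(n)` is NOT
`3`-divisible, and zhang3-p1 g0's `KolyCert.kolyvaginClass_three_ne_zero_of_tower_not_pDiv` (McCallum Cor. 4.5,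
Gross Prop. 3.6 at Zhang–Kolyvagin primes, `Surj W 3`) makes `c₁(n) ≠ 0`; the lower data of the tower come from
Gross 1991 §3 (koly's `kolyvaginRoadThree_towerData_of_grossCM`, p423680). All side conditions (tower surjectivity
at the multiplicative `3`, non-CM, `d_K ∉ {−3,−4}`, `3 ∤ #𝓞_K^×`, `E(K)[3] = 0`, rank one, `Ш(E/K)` finite) are tree
theorems, discharged exactly as in koly's `ClassX11b.bsdp_three_of_kolyvaginClass_one_ne_zero_of_mccallum`.

* `Koly.kolyvaginClass_one_ne_zero_of_bsdp_of_hlFrame` — the converse AT ONE HL frame;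
* `Theorems.zhangSharpFrameAtThreeHL_of_bsdp_onA1` — the converse for the route item;
* `Theorems.bsdp_onA1_of_zhangSharpFrameAtThreeHL` — the forward direction (HL kernel + Darmon 3.6 ∕ Gross §3 for
  the conductor-1 datum), in the same currency;
* `Theorems.zhangSharpFrameAtThreeHL_iff_bsdp_onA1` — the equivalence.

References (locators only): [cite: WZhang2014, Thm. 1.1, Remark 5 and Thm. 10.2 (p. 199, pp. 245–246)]
[cite: McCallumLMS1991, §4 Cor. 4.5, §5 Lemma 5.1 (p. 303) and Cor. 5.6 (p. 310)] [cite: Jetchev2008, §1 (1) and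
Cor. 1.5 (p. 812)] [cite: GrossLMS1991, §3 (pp. 238–239), Prop. 3.6, §4 (4.1)] [cite: JetchevSkinnerWan2017,
§7.4.1–7.4.3 (pp. 30–31)] [cite: HoffsteinLuo1997, main theorem].
-/

noncomputable section

open scoped Classical

namespace Summit.BirchSwinnertonDyer.Rank1Residual.X11b.Three.Koly

open WeierstrassCurve NumberField Literature.NumberTheory.EllipticCurves
  Literature.NumberTheory.EllipticCurves.ModularForms
  Literature.NumberTheory.EllipticCurves.Rank1Residual
  Summit.BirchSwinnertonDyer.Rank1Residual Summit.BirchSwinnertonDyer.Rank1Residual.X11b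

/-! ## §1 The converse at ONE Hoffstein–Luo frame -/

/-- **`BSD(E,3)` at an A1 curve FORCES a non-zero mod-3 Kolyvagin class at every Hoffstein–Luo frame** (W. Zhang
2014, Remark 5 ∕ Thm. 10.2 read backwards, via McCallum 1991 Cor. 5.6 in its divisibility half). Data: `W/ℚ`
globally minimal with `(E,3) ∈ X11b`, a (ram) witness and `3 ∤ ∏_ℓ c_ℓ(E)`; `K` imaginary quadratic with `d_K` ODD,
Heegner for `N_E`, `L(E^{d_K},1) ≠ 0`; a frame `(Dt, β, ι)` with `4N ∣ β² − d_K` and `3 ∤ c(Dt)`. PUBLISHED inputs as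
binders: Gross–Zagier `hGZ`, Kolyvagin `hKo`, Skinner 2016 Thm. C `hSk`, GZK `hGZK`, modularity `hmod`, Shimura
reciprocity at conductor 1 `hrec`, Gross 1991 §3 `h1 h2` (Kolyvagin–Heegner data at every square-free inert level),
McCallum Cor. 5.6's divisibility half `hMcU`. HYPOTHESIS: `BSDp W 3`. CONCLUSION: some Kolyvagin–Heegner datum `d` of
conductor `n` (a square-free product of Zhang–Kolyvagin primes for `p = 3`, `n = 1` allowed) on the frame has
`c₁(n) ≠ 0`. CONDITIONAL on every binder; nothing is booked. [cite: WZhang2014, Remark 5 and Thm. 10.2]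
[cite: McCallumLMS1991, §5 Lemma 5.1 and Cor. 5.6] [cite: Jetchev2008, §1 (1)] -/
theorem kolyvaginClass_one_ne_zero_of_bsdp_of_hlFrame
    (W : WeierstrassCurve ℚ) [W.IsElliptic] [W.IsGloballyMinimal] [NeZero (W.conductorNorm ℤ)]
    (K : Type) [Field K] [NumberField K]
    (Dt : ModularParametrizationData W (W.conductorNorm ℤ)) (β : ℤ) (ι : K →+* ℂ)
    -- published inputs (named facts of the tree)
    (hGZ : gross_zagier (W.conductorNorm ℤ) W K) (hKo : kolyvagin (W.conductorNorm ℤ) W K)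
    (hSk : Skinner2016.thmC_padicValRat_bsd_rank_zero)
    (hGZK : rank_eq_analyticRank_of_analyticRank_le_one) (hmod : hasEntireLFunction_rat)
    (hrec : heegnerPointOfConductor_one_galoisConj (W.conductorNorm ℤ) W K)
    (h1 : phi_heegnerPointOfConductor_mem_range_map_ringClassField (W.conductorNorm ℤ) W K)
    (h2 : exists_generator_ringClassGalOver K)
    (hMcU : McCallum1991_padicValNat_card_sha_primary_add_le_of_globalDivisibility)
    -- the pair (A1) and the HL frame
    (hX : ClassX11b W 3) (hram : Ram W 3) (htam : ¬ 3 ∣ W.tamagawaProduct)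
    (hK : IsImaginaryQuadratic K) (hodd : Odd (NumberField.discr K))
    (hH : SatisfiesHeegnerHypothesis (W.conductorNorm ℤ) K)
    (hLt : (W.quadraticTwist (NumberField.discr K : ℚ)).entireLFunction 1 ≠ 0)
    (hβ : (4 * (W.conductorNorm ℤ : ℤ)) ∣ β ^ 2 - NumberField.discr K) (hc : ¬ (3 : ℤ) ∣ Dt.c)
    -- the hypothesis: the 3-part of BSD for E/ℚ
    (hbsd : BSDp W 3) :
    ∃ (n : ℕ) (d : KolyvaginHeegnerData Dt β ι n),
      KolyvaginDescent.KolSupp (Zhang2014.IsKolyvaginPrime (W.conductorNorm ℤ) W K 3) n ∧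
        d.kolyvaginClass Nat.prime_three 1 ≠ 0 := by
  haveI : Fact (Nat.Prime 3) := ⟨Nat.prime_three⟩
  have hmult : W.HasMultiplicativeReductionAtPrime 3 := hX.2.2.1
  have hirr : Irr W 3 := hX.2.2.2
  have hρ : Surj W 3 := surj_of_irr_of_ram W 3 hirr hram
  -- tower surjectivity at a multiplicative 3 (Wuthrich 2014, Lemma 20; tree theorem), non-CM
  have hsurj : ∀ m : ℕ, W.HasSurjectiveModNGaloisRep (3 ^ m : ℕ) :=
    Rank1Residual.surjective_pow_three_of_mult_of_tateLine W hmult hρ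
  have hCM : ¬ W.HasCM := not_hasCM_of_hasMultiplicativeReductionAtPrime' W hmult
  -- `3 ∣ N` splits in `K`: `3 ∤ d_K`, `3 ∤ #𝓞_K^×`; `d_K ∉ {−3, −4}`
  obtain ⟨h3d, hμ⟩ := not_dvd_discr_and_not_dvd_torsionOrder_of_heegner hK hH (p := 3) (by decide)
    (dvd_conductorNorm_of_classX11b hX)
  have h3 : NumberField.discr K ≠ -3 := by
    intro h
    exact h3d (h ▸ ⟨-1, by norm_num⟩)
  have h4 : NumberField.discr K ≠ -4 := by
    intro h
    rw [h] at hodd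
    exact (Int.not_odd_iff_even.mpr ⟨-2, by norm_num⟩) hodd
  have hDneg : NumberField.discr K < 0 := by
    have hND : IsCoprime (W.conductorNorm ℤ : ℤ) (NumberField.discr K) := by
      have h := Literature.SatisfiesHeegnerHypothesis.coprime_discr hK.1 hH
      refine Int.isCoprime_iff_gcd_eq_one.mpr ?_
      rw [Int.gcd_eq_natAbs, Int.natAbs_natCast]
      exact h
    have hlt := discr_lt_neg_four_of_isCoprime_of_dvd_sq_sub hK hND (dvd_conductorNorm_of_classX11b hX) hβ
    omega
  -- an oriented Heegner datum `H` with `H.β = β`, and THE Heegner point `P = y_K ∈ E(K)` of the frame (Darmon 3.6)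
  obtain ⟨H, hHβ⟩ := exists_heegnerDatum (W.conductorNorm ℤ) hDneg hβ
  obtain ⟨P, hP⟩ := heegnerPointComplex_mem_range_map_holds (W.conductorNorm ℤ) W K hK hH Dt H ι
  -- a globally minimal model of the quadratic twist by `d_K`
  have hD0 : (NumberField.discr K : ℚ) ≠ 0 := by exact_mod_cast NumberField.discr_ne_zero K
  haveI hEt : (W.quadraticTwist (NumberField.discr K : ℚ)).IsElliptic := W.isElliptic_quadraticTwist hD0
  obtain ⟨Cd, hCd⟩ := hasGlobalMinimalModel_rat_holds (W.quadraticTwist (NumberField.discr K : ℚ))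
  haveI := hCd
  -- STEP L at `P` from `BSD(E,3)` (the tree's converse bookkeeping at odd Heegner data)
  have hL : IndexLowerBoundAt W 3 K P :=
    indexLowerBoundAt_of_bsdp_of_heegnerData_of_odd W 3 K Dt H ι P hGZ hKo hSk hGZK hmod hX hram hK hodd hH hP
      (by exact_mod_cast hc) hμ hLt (Cd • W.quadraticTwist (NumberField.discr K : ℚ)) Cd rfl hbsd
  -- arithmetic of `E(K)`: `y_K` non-torsion (GZ), rank one and `Ш` finite (Kolyvagin), no 3-torsion, `3^{M₀} ∥ y_K`
  have hPinf : ¬ IsOfFinAddOrder P :=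
    not_isOfFinAddOrder_of_heegner_of_analyticRank_eq_one W (W.conductorNorm ℤ) K Dt H ι P hGZ hmod hX.1 hK hH
      hLt hP
  obtain ⟨hrank, hSha⟩ := hKo hK hH ⟨Dt, H, ι, hP⟩ hPinf
  haveI : Finite (W.baseChange K).sha := hSha
  have hbot := torsionBy_eq_bot_of_isImaginaryQuadratic_of_hasIrreducibleModPGaloisRep W K hK Nat.prime_three hirr
  have hiv : ∀ x : (W.baseChange K).toAffine.Point, 3 • x = 0 → x = 0 := fun x hx ↦ by
    have hmem : x ∈ AddSubgroup.torsionBy (W.baseChange K).toAffine.Point ((3 : ℕ) : ℤ) := by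
      rw [mem_torsionBy_iff, natCast_zsmul]
      exact hx
    rw [hbot] at hmem
    exact hmem
  haveI : Module.Finite ℤ (W.baseChange K).toAffine.Point := (W.baseChange K).module_finite_point_holds
  obtain ⟨M₀, x₀, hx₀, hmax⟩ := exists_pow_smul_eq_and_forall_ne hPinf (p := 3) (by norm_num)
  have hdiv : ∃ Q : (W.baseChange K).toAffine.Point, ((3 ^ M₀ : ℕ) : ℤ) • Q = P :=
    ⟨x₀, by rw [natCast_zsmul]; exact hx₀⟩
  have hndiv : ¬ ∃ Q : (W.baseChange K).toAffine.Point, ((3 ^ (M₀ + 1) : ℕ) : ℤ) • Q = P := by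
    rintro ⟨Q, hQ⟩
    exact hmax Q (by rw [← natCast_zsmul]; exact hQ)
  -- Kolyvagin–Heegner data at every square-free inert level of the frame (Gross 1991 §3), in particular at 1
  have hKD : ∀ m : ℕ, Squarefree m → (∀ q ∈ m.primeFactors, (Ideal.span {(q : 𝓞 K)}).IsPrime) →
      Nonempty (KolyvaginHeegnerData Dt β ι m) := fun m hm hinert ↦
    Summit.BirchSwinnertonDyer.BirchSwinnertonDyer.Theorems.nonempty_kolyvaginHeegnerData_of_grossCM h1 h2 hK hH
      Dt β ι hβ hm hinert
  obtain ⟨d₁⟩ := hKD 1 squarefree_one (by simp)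
  -- `P(1) = y_K` in `E(K̄)` (Shimura reciprocity at conductor 1)
  have hPd : d₁.toGeomPoints d₁.derivedPoint = toGeomPoints (W.baseChange K) P :=
    KolyvaginBottom.toGeomPoints_derivedPoint_one_eq hrec hK hH hP d₁ hHβ
  -- the two bridges: `ord₃ [E(K):ℤP] = M₀` (McCallum Lemma 5.1) and `ord₃ #Ш = ord₃ #Ш[3^∞]`
  haveI : Finite (AddCommGroup.torsion (W.baseChange K).toAffine.Point) :=
    WeierstrassCurve.finite_torsion_point (W := W.baseChange K)
  obtain ⟨cc, Q, hcQ, hcker⟩ := RankOne.exists_coord_of_mordellWeilRank_eq_one (W.baseChange K) hrank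
  have hidx : padicValNat 3 (AddSubgroup.zmultiples P).index = M₀ :=
    padicValNat_index_zmultiples_eq_of_divisibility cc Q hcQ hcker hiv P hdiv hndiv
  have hsha : padicValNat 3 (W.baseChange K).shaOrder =
      padicValNat 3 (Nat.card (AddCommGroup.primaryComponent (W.baseChange K).sha 3)) :=
    padicValNat_shaOrder_eq (W.baseChange K) 3
  have htam0 : padicValNat 3 W.tamagawaProduct = 0 := padicValNat.eq_zero_of_not_dvd htam
  -- STEP L reads `2 M₀ ≤ ord₃ #Ш(E/K)[3^∞]`
  have hL' : 2 * M₀ ≤ padicValNat 3 (Nat.card (AddCommGroup.primaryComponent (W.baseChange K).sha 3)) := by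
    unfold IndexLowerBoundAt at hL
    rw [hidx, hsha, htam0] at hL
    omega
  -- suppose every class vanishes; then every derived point of the frame is 3-divisible (McCallum Cor. 4.5 read
  -- through the tower theorem), and McCallum's Cor. 5.6 with `M_∞ ≥ 1` contradicts STEP L
  by_contra hneg
  have hdivall : ∀ (s : ℕ), s ≤ 1 → ∀ (n : ℕ) (d : KolyvaginHeegnerData Dt β ι n), Squarefree n →
      (∀ ℓ ∈ n.primeFactors, Zhang2014.IsKolyvaginPrime (W.conductorNorm ℤ) W K 3 ℓ ∧
        s ≤ Zhang2014.kolyvaginIndex W 3 ℓ) →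
      ∃ Q : (W.baseChange (ringClassField K ι n)).toAffine.Point, ((3 ^ s : ℕ) : ℤ) • Q = d.derivedPoint := by
    intro s hs n dn hn hℓ
    rcases Nat.eq_zero_or_pos s with rfl | hs1
    · exact ⟨dn.derivedPoint, by simp⟩
    · obtain rfl : s = 1 := le_antisymm hs hs1
      -- `n` is a square-free product of Zhang–Kolyvagin primes
      have hsupp : KolyvaginDescent.KolSupp (Zhang2014.IsKolyvaginPrime (W.conductorNorm ℤ) W K 3) n :=
        ⟨hn, fun q hq ↦ (hℓ q hq).1⟩
      -- the tower below `dn` (Gross §3 at the lower levels)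
      have hinert : ∀ m : ℕ, m ∣ n → ∀ q ∈ m.primeFactors, (Ideal.span {(q : 𝓞 K)}).IsPrime :=
        fun m hm q hq ↦ (hsupp.2 q (Nat.primeFactors_mono hm hn.ne_zero hq)).2.2.2.2.1
      let d : (m : ℕ) → m ∣ n → KolyvaginHeegnerData Dt β ι m := fun m hm ↦
        if h : m = n then h ▸ dn else Classical.choice (hKD m (hn.squarefree_of_dvd hm) (hinert m hm))
      have hdn : d n dvd_rfl = dn := by
        show (if h : n = n then h ▸ dn else _) = dn
        rw [dif_pos rfl]
      -- if `P(n)` were not 3-divisible, `c₁(n) ≠ 0` — excluded by `hneg`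
      by_contra hnd
      have hcert : ¬ PDiv (d n dvd_rfl) 3 1 := by rwa [hdn]
      have hne := KolyCert.kolyvaginClass_three_ne_zero_of_tower_not_pDiv W K Dt β ι hmult hρ hK hH hsupp d hcert
      rw [hdn] at hne
      exact hneg ⟨n, dn, hsupp, hne⟩
  have hineq := hMcU W hCM K hK h3 h4 hH 3 (by norm_num) hsurj Dt β ι d₁ P hPd hPinf M₀ hdiv hndiv 1 hdivall
  omega

end Summit.BirchSwinnertonDyer.Rank1Residual.X11b.Three.Koly

/-! ## §2 The route item: `ZhangSharpFrameAtThreeHL ⟺ BSD(E,3) on A1`, modulo the published inputs -/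

namespace Summit.BirchSwinnertonDyer.BirchSwinnertonDyer.Theorems

open WeierstrassCurve NumberField Literature.NumberTheory.EllipticCurves
  Literature.NumberTheory.EllipticCurves.ModularForms
  Literature.NumberTheory.EllipticCurves.Rank1Residual
  Summit.BirchSwinnertonDyer.Rank1Residual Summit.BirchSwinnertonDyer.Rank1Residual.X11b
  Summit.BirchSwinnertonDyer.BirchSwinnertonDyer.Theses.KolyvaginRoadThree

/-- **The deciding crux FROM the leaf on A1.**  Granted the published inputs (Gross–Zagier, Kolyvagin, Skinner 2016
Thm. C, GZK, modularity, Shimura reciprocity at conductor 1, Gross 1991 §3 ×2, McCallum Cor. 5.6's divisibility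
half): if `BSDp W 3` holds for every globally minimal `W` with `(E,3) ∈ X11b`, a (ram) witness and `3 ∤ ∏c`, then the
HL crux `ZhangSharpFrameAtThreeHL` (item stmt-BirchSwinnertonDyer-19574) holds — frame by frame,
`Koly.kolyvaginClass_one_ne_zero_of_bsdp_of_hlFrame`. CONDITIONAL on every binder; nothing is booked (in particular
`BSDp W 3` on A1 is a HYPOTHESIS here, the rung's open leaf). [cite: WZhang2014, Remark 5 and Thm. 10.2]
[cite: McCallumLMS1991, §5 Lemma 5.1 and Cor. 5.6] -/
theorem zhangSharpFrameAtThreeHL_of_bsdp_onA1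
    (hGZ : ∀ (N : ℕ) [NeZero N] (W : WeierstrassCurve ℚ) (K : Type) [Field K] [NumberField K],
      gross_zagier N W K)
    (hKo : ∀ (N : ℕ) [NeZero N] (W : WeierstrassCurve ℚ) (K : Type) [Field K] [NumberField K],
      kolyvagin N W K)
    (hSk : Skinner2016.thmC_padicValRat_bsd_rank_zero)
    (hGZK : rank_eq_analyticRank_of_analyticRank_le_one) (hmod : hasEntireLFunction_rat)
    (hrec : ∀ (N : ℕ) [NeZero N] (W : WeierstrassCurve ℚ) (K : Type) [Field K] [NumberField K],
      heegnerPointOfConductor_one_galoisConj N W K)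
    (h1 : ∀ (N : ℕ) [NeZero N] (W : WeierstrassCurve ℚ) (K : Type) [Field K] [NumberField K],
      phi_heegnerPointOfConductor_mem_range_map_ringClassField N W K)
    (h2 : ∀ (K : Type) [Field K] [NumberField K], exists_generator_ringClassGalOver K)
    (hMcU : McCallum1991_padicValNat_card_sha_primary_add_le_of_globalDivisibility)
    (hbsd : ∀ (W : WeierstrassCurve ℚ) [W.IsElliptic] [W.IsGloballyMinimal],
      ClassX11b W 3 → Ram W 3 → ¬ 3 ∣ W.tamagawaProduct → BSDp W 3) :
    ZhangSharpFrameAtThreeHL := by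
  intro W _ _ _ K _ _ Dt β ι hX _hmult _hsurj hram htam hK hodd hH hLt _h3 hβ hc
  exact Summit.BirchSwinnertonDyer.Rank1Residual.X11b.Three.Koly.kolyvaginClass_one_ne_zero_of_bsdp_of_hlFrame W K
    Dt β ι (hGZ _ W K) (hKo _ W K) hSk hGZK hmod (hrec _ W K) (h1 _ W K) (h2 K) hMcU hX hram htam hK hodd hH hLt
    hβ hc (hbsd W hX hram htam)

/-- **The leaf on A1 FROM the deciding crux** (the forward direction, in the same currency): the HL kernel
`Koly.bsdp_three_onA1_of_kolyvaginFramesHL` (p424749) with its seam `hKD` (conductor-1 Kolyvagin–Heegner data)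
discharged by Gross 1991 §3 (`kolyvaginRoadThree_towerData_of_grossCM` at level 1, koly p423680). CONDITIONAL on
every binder; nothing is booked. [cite: WZhang2014, Thm. 1.1 and Remark 5] [cite: McCallumLMS1991, §5 Cor. 5.6] -/
theorem bsdp_onA1_of_zhangSharpFrameAtThreeHL
    (hGZ : ∀ (N : ℕ) [NeZero N] (W : WeierstrassCurve ℚ) (K : Type) [Field K] [NumberField K],
      gross_zagier N W K)
    (hKo : ∀ (N : ℕ) [NeZero N] (W : WeierstrassCurve ℚ) (K : Type) [Field K] [NumberField K],
      kolyvagin N W K)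
    (hB : ∀ (N : ℕ) [NeZero N] (W : WeierstrassCurve ℚ) (K : Type) [Field K] [NumberField K],
      Kolyvagin1990_padicValNat_card_sha_le N W K)
    (hSk : Skinner2016.thmC_padicValRat_bsd_rank_zero)
    (hGZK : rank_eq_analyticRank_of_analyticRank_le_one) (hmod : hasEntireLFunction_rat)
    (hnf : exists_isNewformOf) (hHL : HoffsteinLuo1997_exists_twist_L_one_ne_zero)
    (hMaz : mazur_not_dvd_maninConstant_of_odd)
    (hrec : ∀ (N : ℕ) [NeZero N] (W : WeierstrassCurve ℚ) (K : Type) [Field K] [NumberField K],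
      heegnerPointOfConductor_one_galoisConj N W K)
    (hMc : McCallum1991_pow_dvd_card_sha_primary_of_certificate)
    (h1 : ∀ (N : ℕ) [NeZero N] (W : WeierstrassCurve ℚ) (K : Type) [Field K] [NumberField K],
      phi_heegnerPointOfConductor_mem_range_map_ringClassField N W K)
    (h2 : ∀ (K : Type) [Field K] [NumberField K], exists_generator_ringClassGalOver K)
    (hZ : ZhangSharpFrameAtThreeHL) :
    ∀ (W : WeierstrassCurve ℚ) [W.IsElliptic] [W.IsGloballyMinimal],
      ClassX11b W 3 → Ram W 3 → ¬ 3 ∣ W.tamagawaProduct → BSDp W 3 :=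
  fun W _ _ hX hram htam ↦
    Summit.BirchSwinnertonDyer.Rank1Residual.X11b.Three.Koly.bsdp_three_onA1_of_kolyvaginFramesHL hGZ hKo hB hSk
      hGZK hmod hnf hHL hMaz hrec hMc
      (fun W _ _ _ K _ _ Dt β ι hK hH hβ ↦
        kolyvaginRoadThree_towerData_of_grossCM h1 h2 W K Dt β ι 1 hK hH hβ squarefree_one (by simp))
      hZ W hX hram htam

/-- **THE EQUIVALENCE.**  Modulo the published inputs of the route (all binders: Gross–Zagier, Kolyvagin ×2,
Skinner 2016 Thm. C, GZK, modularity, newforms, Hoffstein–Luo, Mazur's Manin constant, Shimura reciprocity at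
conductor 1, McCallum 1991 Cor. 5.6 in BOTH halves, Gross 1991 §3 ×2), the deciding crux of
`route-BirchSwinnertonDyer-KolyvaginRoadThree` is EQUIVALENT to the rung-K2@3 leaf `X11b.MultiplicativeRankOneAtThree`
RESTRICTED TO ATOM A1 (`Ram W 3 ∧ ¬ 3 ∣ ∏c`):
`ZhangSharpFrameAtThreeHL ↔ ∀ W, ClassX11b W 3 → Ram W 3 → ¬ 3 ∣ W.tamagawaProduct → BSDp W 3`.
The crux therefore carries no surplus over the target on its atom, and a refutation of it is a refutation of the
`3`-part of BSD at an A1 curve. CONDITIONAL on every binder; nothing is booked; BSD is proved for no curve here.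
[cite: WZhang2014, Thm. 1.1, Remark 5 and Thm. 10.2] [cite: McCallumLMS1991, §5 Lemma 5.1 and Cor. 5.6]
[cite: Jetchev2008, §1 (1)] -/
theorem zhangSharpFrameAtThreeHL_iff_bsdp_onA1
    (hGZ : ∀ (N : ℕ) [NeZero N] (W : WeierstrassCurve ℚ) (K : Type) [Field K] [NumberField K],
      gross_zagier N W K)
    (hKo : ∀ (N : ℕ) [NeZero N] (W : WeierstrassCurve ℚ) (K : Type) [Field K] [NumberField K],
      kolyvagin N W K)
    (hB : ∀ (N : ℕ) [NeZero N] (W : WeierstrassCurve ℚ) (K : Type) [Field K] [NumberField K],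
      Kolyvagin1990_padicValNat_card_sha_le N W K)
    (hSk : Skinner2016.thmC_padicValRat_bsd_rank_zero)
    (hGZK : rank_eq_analyticRank_of_analyticRank_le_one) (hmod : hasEntireLFunction_rat)
    (hnf : exists_isNewformOf) (hHL : HoffsteinLuo1997_exists_twist_L_one_ne_zero)
    (hMaz : mazur_not_dvd_maninConstant_of_odd)
    (hrec : ∀ (N : ℕ) [NeZero N] (W : WeierstrassCurve ℚ) (K : Type) [Field K] [NumberField K],
      heegnerPointOfConductor_one_galoisConj N W K)
    (hMc : McCallum1991_pow_dvd_card_sha_primary_of_certificate)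
    (hMcU : McCallum1991_padicValNat_card_sha_primary_add_le_of_globalDivisibility)
    (h1 : ∀ (N : ℕ) [NeZero N] (W : WeierstrassCurve ℚ) (K : Type) [Field K] [NumberField K],
      phi_heegnerPointOfConductor_mem_range_map_ringClassField N W K)
    (h2 : ∀ (K : Type) [Field K] [NumberField K], exists_generator_ringClassGalOver K) :
    ZhangSharpFrameAtThreeHL ↔
      ∀ (W : WeierstrassCurve ℚ) [W.IsElliptic] [W.IsGloballyMinimal],
        ClassX11b W 3 → Ram W 3 → ¬ 3 ∣ W.tamagawaProduct → BSDp W 3 :=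
  ⟨bsdp_onA1_of_zhangSharpFrameAtThreeHL hGZ hKo hB hSk hGZK hmod hnf hHL hMaz hrec hMc h1 h2,
    zhangSharpFrameAtThreeHL_of_bsdp_onA1 hGZ hKo hSk hGZK hmod hrec h1 h2 hMcU⟩

end Summit.BirchSwinnertonDyer.BirchSwinnertonDyer.Theorems

end
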